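import Summits.ValiantsHypothesis.ValiantsHypothesis.Theorems.LacunarySymmetroidDoorA26StubDefs
import Summits.ValiantsHypothesis.ValiantsHypothesis.Theorems.LacunarySymmetroidMatrixDescartesCensusChamberCover

/-!
# Route `LacunarySymmetroid`, crux `DoorA26` (stmt-ValiantsHypothesis-19979), line `census` — stub `stub_chamberCover` CLOSED BY NAME

The registered stub `stub_chamberCover` of the skeleton `Cruxes/DoorA26/Lines/census.lean` (sha `1fb9861a1feadc1e…`) has the one-line
signature `Stmt.stub_chamberCover` (COMPLETENESS OF THE 2 608-CHAMBER TABLE: every sorted generic support `0 = d₀ < ⋯ < d₅` with a covering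
order of strictly increasing pair sums lies in a listed chamber `Census.chamber n`, `n < 2608`).  Its statement is imported from
`Theorems/LacunarySymmetroidDoorA26StubDefs.lean` (same namespace `…Cruxes.DoorA26.Census`, verbatim the skeleton), and its CONTENT is the tree
theorem `Census.chamberCover` (`…CensusChamberCover`, val-sym-door-p5 g6: the table-guided comparison tree, 2 608 leaves, parts 01–17) — the
same statement character for character over the landed table `…CensusChamberTableA/B`.  This file is the one-line identification, so that the
stub closes BY NAME on the ledger (`--supports stmt-ValiantsHypothesis-19979`).

HONEST FRAMING.  Finite combinatorics; kills no chamber, bounds no census count; `DoorA26` (`= PosRootLawAt 2 6 19`) stays OPEN (its line still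
has `stub_easyChambers` and `stub_hardChambers` open); registers unchanged (`ζ_sym(2,6) ∈ {18,19,20}`, 18 attained, never > 18); nothing on
`MatrixDescartes` (stmt-ValiantsHypothesis-18050) or on `VP ≠ VNP`.
-/

-- `Summit.ValiantsHypothesis.ValiantsHypothesis.…` repeats a component by the D-0017 layout
-- (single-conjunct summit), which the `dupNamespace` linter flags; the name is mandated.
set_option linter.dupNamespace false

namespace Summit.ValiantsHypothesis.ValiantsHypothesis.Cruxes.DoorA26.Census

open Summit.ValiantsHypothesis.ValiantsHypothesis.Theorems.LacunarySymmetroidMatrixDescartes.Census (chamberCover)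

/-- **Registered stub 1 of the line `census` — `Stmt.stub_chamberCover` (completeness of the 2 608-chamber table) HOLDS**, by the tree
theorem `Census.chamberCover` (verbatim the same statement). -/
theorem stub_chamberCover : Stmt.stub_chamberCover := by
  unfold Stmt.stub_chamberCover
  exact chamberCover

end Summit.ValiantsHypothesis.ValiantsHypothesis.Cruxes.DoorA26.Census
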